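import Literature.NumberTheory.EllipticCurves.KummerUnramified
import Literature.NumberTheory.EllipticCurves.KummerUnramifiedConverse
import Literature.NumberTheory.Automorphic.GaloisActionPlaces
import Mathlib.NumberTheory.RamificationInertia.Valuation
import Mathlib.NumberTheory.RamificationInertia.Galois
import HarnessLib

/-!
# Multi-Kummer fields `k(∛p : p ∈ S)` over `k = ℚ(ρ)`: Galois group and unramified primes

Topic `NumberTheory/GaloisRepresentations`; namespace
`Literature.NumberTheory.GaloisRepresentations.MultiKummer`. Everything PROVED; no named facts.

This is the Galois-theoretic frame of Cassels' construction of `d = Norm_{Ω/ℚ} δ`,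
`Ω = ℚ(p₁^{1/3}, …, p_T^{1/3})` (J. W. S. Cassels, *Arithmetic on curves of genus 1. VI. The
Tate–Šafarevič group can be arbitrarily large*, J. reine angew. Math. 214/215 (1964) 65–70, pp. 67–70:
"Let `Ω = ℚ(p₁^{1/3}, …, p_T^{1/3})`. We shall actually find `d` in the shape `d = Norm_{Ω/ℚ} δ`";
the automorphisms `D : d^{1/3} ↦ ρd^{1/3}` and `M : m^{1/3} ↦ ρm^{1/3}` of p. 67; the prime divisors
`𝔓_j, 𝔔_i` of absolute degree `1` of p. 68), set up ABSTRACTLY: a finite Galois extension `L/k` of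
number fields together with `ρ ∈ k` (`ρ² + ρ + 1 = 0`), a finite set `S` of rational primes and cube
roots `μ_p ∈ L` (`μ_p³ = p`, `p ∈ S`) generating `L` over `k` (`IsMultiKummer`). We prove
(Kummer theory, e.g. Cassels–Fröhlich Ch. III §2; Lang, *Algebraic Number Theory* VI §8 / *FDG* Ch. 6
Prop. 1.3 for the unramifiedness):

* `expnt σ p ∈ ℤ/3` with `σ μ_p = ρ^{expnt σ p} μ_p` (`apply_root`), additive in `σ` (`expnt_mul`);
  `σ = 1` iff all `expnt σ p = 0` (`eq_one_of_forall_expnt_eq_zero`); hence `Gal(L/k)` is abelian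
  (`mul_comm_gal`) and embeds into `(ℤ/3)^S` (`expntHom_injective`);
* elements of `L` fixed by `Gal(L/k)` lie in `k` (`mem_range_of_forall_fixed`, Galois theory);
* **unramifiedness outside `3 ∏ S`**: at a prime `w` of `𝓞 L` not containing `3 ∏_{p ∈ S} p` the
  inertia group is trivial (`inertia_eq_bot`), so `e(w | w ∩ 𝓞 k) = 1` (`ramificationIdx'_eq_one`)
  and the `w`-adic valuation restricts to the `(w ∩ 𝓞 k)`-adic valuation of `k`
  (`valuation_algebraMap_eq`) — the inertia fixes the cube roots of `w`-units (tree
  `smul_eq_self_of_mem_inertia_of_pow_eq`), and `#I = e` for Galois extensions (Mathlib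
  `Ideal.card_inertia_eq_ramificationIdxIn`).

The degree `[L : k] = 3^{#S}`, the automorphisms `M_p` and the primes above `p ∈ S` and above inert
`q ∉ S` are treated in the sequel `MultiKummerPrimes.lean`; the realisation inside an algebraic
closure in `MultiKummerConstruction.lean`.

## References

* J. W. S. Cassels, *Arithmetic on curves of genus 1. VI*, J. reine angew. Math. 214/215 (1964),
  65–70, pp. 67–68. [Cassels1964ArithmeticVI]
* S. Lang, *Fundamentals of Diophantine Geometry*, Springer 1983, Ch. 6 Prop. 1.3 (unramified Kummer
  extensions). [Lang1983]
* J. H. Silverman, *The Arithmetic of Elliptic Curves*, 2nd ed. (2009), VIII §1 (Kummer pairing),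
  proof of Prop. VIII.1.6. [SilvermanAEC2009]
-/

noncomputable section

open scoped NumberField Pointwise

open NumberField IsDedekindDomain Literature.NumberTheory.EllipticCurves

universe u

namespace Literature.NumberTheory.GaloisRepresentations

namespace MultiKummer

variable {k L : Type u} [Field k] [Field L] [Algebra k L]

/-! ## The abstract set-up -/

/-- **A multi-Kummer field of exponent `3`.** `L/k` with `ρ ∈ k` a primitive cube root of unity
(`ρ² + ρ + 1 = 0`), `S` a finite set of rational primes `≡ 2 (mod 3)`, and chosen cube roots
`μ_p ∈ L` of `p ∈ S` generating `L` over `k` — Cassels' `Ω k = k(p₁^{1/3}, …, p_T^{1/3})`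
([VI] p. 67). [cite: Cassels1964ArithmeticVI, p. 67] -/
structure IsMultiKummer (ρ : k) (S : Finset ℕ) (μ : ℕ → L) : Prop where
  rho_sq : ρ ^ 2 + ρ + 1 = 0
  prime_of_mem : ∀ p ∈ S, p.Prime ∧ p % 3 = 2
  pow_three : ∀ p ∈ S, μ p ^ 3 = (p : L)
  adjoin_eq_top : IntermediateField.adjoin k (μ '' (S : Set ℕ)) = ⊤

variable {ρ : k} {S : Finset ℕ} {μ : ℕ → L}

section Basic

variable (H : IsMultiKummer ρ S μ)
include H

/-- `ρ³ = 1`. [folklore] -/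
theorem rho_pow_three : ρ ^ 3 = 1 := by linear_combination (ρ - 1) * H.rho_sq

/-- `ρ` is a primitive cube root of unity (characteristic `0`). [folklore] -/
theorem isPrimitiveRoot_rho [CharZero k] : IsPrimitiveRoot ρ 3 := by
  have h1 : ρ ≠ 1 := by
    intro h; have := H.rho_sq; rw [h] at this; norm_num at this
  exact (orderOf_eq_prime (rho_pow_three H) h1) ▸ IsPrimitiveRoot.orderOf ρ

/-- `μ_p ≠ 0` for `p ∈ S`. [folklore] -/
theorem root_ne_zero [CharZero L] {p : ℕ} (hp : p ∈ S) : μ p ≠ 0 := by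
  intro h
  have := H.pow_three p hp
  rw [h, zero_pow three_ne_zero] at this
  exact (H.prime_of_mem p hp).1.ne_zero (by exact_mod_cast this.symm)

/-- `μ_p³ = p` as an element of `k` pushed to `L`. [folklore] -/
theorem pow_three_eq_algebraMap {p : ℕ} (hp : p ∈ S) : μ p ^ 3 = algebraMap k L (p : k) := by
  rw [H.pow_three p hp, map_natCast]

/-! ## The exponents `expnt σ p ∈ ℤ/3` -/

/-- The powers `ρ^{c.val}` (`c ∈ ℤ/3`) are distinct. [folklore] -/
theorem rho_pow_val_injective [CharZero k] : Function.Injective fun c : ZMod 3 => ρ ^ c.val := by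
  intro c c' h
  exact ZMod.val_injective 3 ((isPrimitiveRoot_rho H).pow_inj (ZMod.val_lt c) (ZMod.val_lt c') h)

/-- `ρ^{(c + c').val} = ρ^{c.val} ρ^{c'.val}`. [folklore] -/
theorem rho_pow_val_add (c c' : ZMod 3) : ρ ^ (c + c').val = ρ ^ c.val * ρ ^ c'.val := by
  rw [← pow_add, ZMod.val_add]
  conv_rhs => rw [← Nat.mod_add_div (c.val + c'.val) 3, pow_add, pow_mul, rho_pow_three H, one_pow,
    mul_one]

/-- **Every `σ ∈ Gal(L/k)` multiplies `μ_p` by a unique cube root of unity `ρ^c`, `c ∈ ℤ/3`**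
(the conjugates of `p^{1/3}` over `k ∋ ρ` are the `ρⁱ p^{1/3}`).
[cite: SilvermanAEC2009, VIII §1 (proof of Prop. 1.2)] -/
theorem existsUnique_apply_root [CharZero k] [CharZero L] (σ : L ≃ₐ[k] L) {p : ℕ} (hp : p ∈ S) :
    ∃! c : ZMod 3, σ (μ p) = algebraMap k L ρ ^ c.val * μ p := by
  obtain ⟨i, hi, h⟩ := exists_algEquiv_apply_eq_pow_mul (by norm_num) (isPrimitiveRoot_rho H)
    (show (p : k) ≠ 0 by exact_mod_cast (H.prime_of_mem p hp).1.ne_zero) (pow_three_eq_algebraMap H hp) σ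
  refine ⟨(i : ZMod 3), ?_, fun c hc => ?_⟩
  · change σ (μ p) = algebraMap k L ρ ^ (i : ZMod 3).val * μ p
    rw [ZMod.val_natCast, Nat.mod_eq_of_lt hi, h]
  · apply rho_pow_val_injective H
    change ρ ^ c.val = ρ ^ (i : ZMod 3).val
    rw [ZMod.val_natCast, Nat.mod_eq_of_lt hi]
    have h2 : algebraMap k L ρ ^ c.val * μ p = algebraMap k L ρ ^ i * μ p := by rw [← hc, h]
    have h3 := mul_right_cancel₀ (root_ne_zero H hp) h2
    rw [← map_pow, ← map_pow] at h3
    exact (algebraMap k L).injective h3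

/-- **The exponent** `expnt σ p ∈ ℤ/3` of `σ` at `p`: `σ μ_p = ρ^{expnt σ p} μ_p` (junk `0` for
`p ∉ S`). Cassels' `M_j` are the automorphisms with `expnt = δ_{jl}` ([VI] p. 67).
[cite: Cassels1964ArithmeticVI, p. 67] -/
def expnt (_H : IsMultiKummer ρ S μ) (σ : L ≃ₐ[k] L) (p : ℕ) : ZMod 3 :=
  haveI := Classical.dec
  if h : ∃ c : ZMod 3, σ (μ p) = algebraMap k L ρ ^ c.val * μ p then h.choose else 0

/-- Defining property: `σ μ_p = ρ^{expnt σ p} μ_p` for `p ∈ S`. [folklore] -/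
theorem apply_root [CharZero k] [CharZero L] (σ : L ≃ₐ[k] L) {p : ℕ} (hp : p ∈ S) :
    σ (μ p) = algebraMap k L ρ ^ (expnt H σ p).val * μ p := by
  have hex := (existsUnique_apply_root H σ hp).exists
  unfold expnt
  rw [dif_pos hex]
  exact hex.choose_spec

/-- Characterisation of `expnt`. [folklore] -/
theorem expnt_eq_iff [CharZero k] [CharZero L] (σ : L ≃ₐ[k] L) {p : ℕ} (hp : p ∈ S) {c : ZMod 3} :
    expnt H σ p = c ↔ σ (μ p) = algebraMap k L ρ ^ c.val * μ p := by
  constructor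
  · rintro rfl; exact apply_root H σ hp
  · intro h
    exact (existsUnique_apply_root H σ hp).unique (apply_root H σ hp) h

/-- `expnt 1 p = 0`. [folklore] -/
theorem expnt_one [CharZero k] [CharZero L] {p : ℕ} (hp : p ∈ S) : expnt H 1 p = 0 := by
  rw [expnt_eq_iff H 1 hp, ZMod.val_zero, pow_zero, one_mul, AlgEquiv.one_apply]

/-- **Additivity:** `expnt (σ τ) p = expnt σ p + expnt τ p`. [folklore] -/
theorem expnt_mul [CharZero k] [CharZero L] (σ τ : L ≃ₐ[k] L) {p : ℕ} (hp : p ∈ S) :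
    expnt H (σ * τ) p = expnt H σ p + expnt H τ p := by
  rw [expnt_eq_iff H _ hp, AlgEquiv.mul_apply, apply_root H τ hp, map_mul, map_pow, AlgEquiv.commutes,
    apply_root H σ hp, ← mul_assoc, ← map_pow, ← map_pow, ← map_mul, ← rho_pow_val_add H, add_comm,
    map_pow]

/-- `expnt σ⁻¹ p = - expnt σ p`. [folklore] -/
theorem expnt_inv [CharZero k] [CharZero L] (σ : L ≃ₐ[k] L) {p : ℕ} (hp : p ∈ S) :
    expnt H σ⁻¹ p = -expnt H σ p := by
  have h := expnt_mul H σ σ⁻¹ hp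
  rw [mul_inv_cancel, expnt_one H hp] at h
  linear_combination -h

/-- **An automorphism fixing every `μ_p` is the identity** (the `μ_p` generate `L/k`). [folklore] -/
theorem eq_one_of_forall_apply_root (σ : L ≃ₐ[k] L) (hσ : ∀ p ∈ S, σ (μ p) = μ p) : σ = 1 := by
  apply AlgEquiv.ext
  intro x
  have hx : x ∈ IntermediateField.adjoin k (μ '' (S : Set ℕ)) := by rw [H.adjoin_eq_top]; trivial
  induction hx using IntermediateField.adjoin_induction with
  | mem x hx =>
    obtain ⟨p, hp, rfl⟩ := hx
    exact hσ p hp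
  | algebraMap x => exact σ.commutes x
  | add x y _ _ hx hy => rw [map_add, hx, hy]; rfl
  | inv x _ hx => rw [map_inv₀, hx]; rfl
  | mul x y _ _ hx hy => rw [map_mul, hx, hy]; rfl

/-- `σ = 1` iff all exponents vanish. [folklore] -/
theorem eq_one_of_forall_expnt_eq_zero [CharZero k] [CharZero L] (σ : L ≃ₐ[k] L)
    (hσ : ∀ p ∈ S, expnt H σ p = 0) : σ = 1 :=
  eq_one_of_forall_apply_root H σ fun p hp => by
    rw [apply_root H σ hp, hσ p hp, ZMod.val_zero, pow_zero, one_mul]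

/-- Two automorphisms with the same exponents are equal. [folklore] -/
theorem eq_of_forall_expnt_eq [CharZero k] [CharZero L] {σ τ : L ≃ₐ[k] L}
    (h : ∀ p ∈ S, expnt H σ p = expnt H τ p) : σ = τ := by
  have : σ * τ⁻¹ = 1 := eq_one_of_forall_expnt_eq_zero H _ fun p hp => by
    rw [expnt_mul H _ _ hp, expnt_inv H _ hp, h p hp, add_neg_cancel]
  rw [← mul_inv_eq_one]; exact this

/-- **`Gal(L/k)` is abelian** (it embeds into `(ℤ/3)^S`). [folklore] -/
theorem mul_comm_gal [CharZero k] [CharZero L] (σ τ : L ≃ₐ[k] L) : σ * τ = τ * σ :=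
  eq_of_forall_expnt_eq H fun p hp => by rw [expnt_mul H _ _ hp, expnt_mul H _ _ hp, add_comm]

/-- The exponent vector as a group homomorphism `Gal(L/k) → (ℤ/3)^S` (additive target written
multiplicatively). [folklore] -/
def expntHom [CharZero k] [CharZero L] (_H : IsMultiKummer ρ S μ) :
    (L ≃ₐ[k] L) →* Multiplicative (↥S → ZMod 3) where
  toFun σ := Multiplicative.ofAdd fun p => expnt _H σ p
  map_one' := by
    rw [← ofAdd_zero]; congr 1; funext p; exact expnt_one _H p.2
  map_mul' σ τ := by
    rw [← ofAdd_add]; congr 1; funext p; exact expnt_mul _H σ τ p.2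

/-- Unfolding `expntHom`. [folklore] -/
@[simp] theorem expntHom_apply [CharZero k] [CharZero L] (σ : L ≃ₐ[k] L) (p : ↥S) :
    (expntHom H σ).toAdd p = expnt H σ p := rfl

/-- **`Gal(L/k) ↪ (ℤ/3)^S`.** [folklore] -/
theorem expntHom_injective [CharZero k] [CharZero L] : Function.Injective (expntHom H) := by
  intro σ τ h
  exact eq_of_forall_expnt_eq H fun p hp => by
    have := congrArg (fun f => (Multiplicative.toAdd f) ⟨p, hp⟩) h
    exact this

end Basic

/-! ## Fixed elements and integrality -/

section Fixed

variable [NumberField k] [NumberField L] (H : IsMultiKummer ρ S μ)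
include H

omit H in
/-- `L/k` is finite-dimensional (both are number fields). [folklore] -/
theorem finiteDimensional : FiniteDimensional k L := Module.Finite.of_restrictScalars_finite ℚ k L

omit H in
/-- **Galois theory:** an element of `L` fixed by every `σ ∈ Gal(L/k)` lies in `k`.
[folklore] -/
theorem mem_range_of_forall_fixed [IsGalois k L] {x : L} (hx : ∀ σ : L ≃ₐ[k] L, σ x = x) :
    x ∈ Set.range (algebraMap k L) := by
  haveI : FiniteDimensional k L := finiteDimensional
  exact (IsGalois.mem_range_algebraMap_iff_fixed x).mpr hx

end Fixed

section IntRoot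

variable (H : IsMultiKummer ρ S μ)
include H

/-- `μ_p` is an algebraic integer. [folklore] -/
theorem isIntegral_root {p : ℕ} (hp : p ∈ S) : IsIntegral ℤ (μ p) := by
  refine IsIntegral.of_pow (by norm_num : 0 < 3) ?_
  rw [H.pow_three p hp]
  have : IsIntegral ℤ (algebraMap ℤ L (p : ℤ)) := isIntegral_algebraMap
  simpa using this

/-- The integral cube root `μ_p ∈ 𝓞 L`. [folklore] -/
def intRoot {p : ℕ} (hp : p ∈ S) : 𝓞 L := ⟨μ p, isIntegral_root H hp⟩

/-- `(intRoot hp : L) = μ_p`. [folklore] -/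
@[simp] theorem coe_intRoot {p : ℕ} (hp : p ∈ S) : (intRoot H hp : L) = μ p := rfl

/-- `intRoot hp ^ 3 = p` in `𝓞 L`. [folklore] -/
theorem intRoot_pow_three {p : ℕ} (hp : p ∈ S) : intRoot H hp ^ 3 = (p : 𝓞 L) := by
  apply RingOfIntegers.ext
  change μ p ^ 3 = ((p : 𝓞 L) : L)
  rw [H.pow_three p hp]
  rfl

/-- The Galois action on `𝓞 L` at `intRoot`: `σ • intRoot = σ μ_p`. [folklore] -/
theorem coe_smul_intRoot (σ : L ≃ₐ[k] L) {p : ℕ} (hp : p ∈ S) :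
    ((σ • intRoot H hp : 𝓞 L) : L) = σ (μ p) := rfl

end IntRoot

/-! ## Unramifiedness outside `3 ∏ S` -/

section ProdNotMem

/-- The hypothesis "`w ∤ 3 ∏ S`" from "`3 ∏_{p ∈ S} p ∉ w`". [folklore] -/
theorem not_mem_of_prod_not_mem (S : Finset ℕ) (w : HeightOneSpectrum (𝓞 L))
    (h : ((3 * ∏ p ∈ S, p : ℕ) : 𝓞 L) ∉ w.asIdeal) :
    (3 : 𝓞 L) ∉ w.asIdeal ∧ ∀ p ∈ S, (p : 𝓞 L) ∉ w.asIdeal := by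
  constructor
  · intro h3
    apply h
    push_cast
    exact w.asIdeal.mul_mem_right _ h3
  · intro p hp hpw
    apply h
    push_cast
    rw [← Finset.mul_prod_erase S (fun p => (p : 𝓞 L)) hp]
    exact w.asIdeal.mul_mem_left _ (w.asIdeal.mul_mem_right _ hpw)

end ProdNotMem

section Unramified

variable [NumberField k] [NumberField L] [IsGalois k L] (H : IsMultiKummer ρ S μ)
include H

omit [NumberField k] [NumberField L] [IsGalois k L] in
/-- **The inertia group of a prime `w ∤ 3 ∏ S` of `L` is trivial** (Lang, *FDG* Ch. 6 Prop. 1.3: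
`k(a^{1/m})/k` is unramified at `v ∤ m·a`): an element of the inertia group fixes each `μ_p`, a cube
root of the `w`-unit `p` (tree `smul_eq_self_of_mem_inertia_of_pow_eq`), hence is the identity.
[cite: Lang1983, Ch. 6 Prop. 1.3] -/
theorem inertia_eq_bot (w : HeightOneSpectrum (𝓞 L)) (h3 : (3 : 𝓞 L) ∉ w.asIdeal)
    (hS : ∀ p ∈ S, (p : 𝓞 L) ∉ w.asIdeal) : w.asIdeal.inertia (L ≃ₐ[k] L) = ⊥ := by
  rw [eq_bot_iff]
  intro σ hσ
  rw [Subgroup.mem_bot]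
  haveI := w.isPrime
  refine eq_one_of_forall_apply_root H σ fun p hp => ?_
  have hfix : σ • intRoot H hp = intRoot H hp :=
    smul_eq_self_of_mem_inertia_of_pow_eq w.asIdeal (d := 3) (by exact_mod_cast h3) (hS p hp)
      (intRoot_pow_three H hp) hσ (by
        apply RingOfIntegers.ext
        change σ ((p : 𝓞 L) : L) = ((p : 𝓞 L) : L)
        simp)
  have := congrArg (fun x : 𝓞 L => (x : L)) hfix
  simpa only [coe_smul_intRoot, coe_intRoot] using this

/-- **`e(w | w ∩ 𝓞 k) = 1` for `w ∤ 3 ∏ S`** (`#I_w = e` in a Galois extension, Mathlib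
`Ideal.card_inertia_eq_ramificationIdxIn`). [cite: Lang1983, Ch. 6 Prop. 1.3] -/
theorem ramificationIdx'_eq_one (w : HeightOneSpectrum (𝓞 L)) (h3 : (3 : 𝓞 L) ∉ w.asIdeal)
    (hS : ∀ p ∈ S, (p : 𝓞 L) ∉ w.asIdeal) :
    (w.under (𝓞 k)).asIdeal.ramificationIdx' w.asIdeal = 1 := by
  haveI : FiniteDimensional k L := finiteDimensional
  haveI : Module.Finite (𝓞 k) (𝓞 L) := IsIntegralClosure.finite (𝓞 k) k L (𝓞 L)
  haveI : IsGaloisGroup (L ≃ₐ[k] L) (𝓞 k) (𝓞 L) :=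
    IsGaloisGroup.of_isFractionRing (L ≃ₐ[k] L) (𝓞 k) (𝓞 L) k L
  haveI := w.isPrime
  haveI := (w.under (𝓞 k)).isPrime
  haveI : w.asIdeal.LiesOver (w.under (𝓞 k)).asIdeal := ⟨rfl⟩
  rw [Ideal.ramificationIdx'_eq_ramificationIdx _ w.asIdeal (w.under (𝓞 k)).ne_bot,
    ← Ideal.ramificationIdxIn_eq_ramificationIdx (w.under (𝓞 k)).asIdeal w.asIdeal (L ≃ₐ[k] L),
    ← Ideal.card_inertia_eq_ramificationIdxIn (G := L ≃ₐ[k] L) (w.under (𝓞 k)).asIdeal w.asIdeal,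
    inertia_eq_bot H w h3 hS, Subgroup.card_bot]

/-- **Valuations restrict without ramification factor**: for `w ∤ 3 ∏ S` and `x ∈ k`,
`v_w(x) = v_{w ∩ 𝓞 k}(x)`. [cite: Lang1983, Ch. 6 Prop. 1.3] -/
theorem valuation_algebraMap_eq (w : HeightOneSpectrum (𝓞 L)) (h3 : (3 : 𝓞 L) ∉ w.asIdeal)
    (hS : ∀ p ∈ S, (p : 𝓞 L) ∉ w.asIdeal) (x : k) :
    w.valuation L (algebraMap k L x) = (w.under (𝓞 k)).valuation k x := by
  haveI : w.asIdeal.LiesOver (w.under (𝓞 k)).asIdeal := ⟨rfl⟩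
  have h := HeightOneSpectrum.valuation_liesOver L (w.under (𝓞 k)) w x
  rw [ramificationIdx'_eq_one H w h3 hS, pow_one] at h
  exact h.symm

end Unramified

end MultiKummer

end Literature.NumberTheory.GaloisRepresentations
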